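import Summits.ResolutionOfSingularities.ResolutionOfSingularities.Theorems.HilbertSamuelEliminationSigmaMaxModificationsCorridor3SigmaBoundaryDefs
import Summits.ResolutionOfSingularities.ResolutionOfSingularities.Theorems.HilbertSamuelEliminationSigmaMaxModificationsCorridor3RegularCentresPermissible
import HarnessLib

/-!
# [OURS · L1 W4.2] σ-LAYER (E2′) — `Corridor3SigmaMenuDefs`: the INTRINSIC MENU of centres at a point and the FULL-CORNER LOCUS

Crux chain w42 (`SigmaMaxModifications`, stmt-ResolutionOfSingularities-18506; conjunct `SigmaMaxModificationsCorridor3`,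
stmt-ResolutionOfSingularities-19249), σ-layer; object «INTRINSIC MENU + CORNER LOCUS» (res-L1-w42-plan-1 RULINGS v3.14-11c (CS)/(CT),
(CU), v3.14-12 (BR-6)/(BR-7) (E2′)), typer res-type-067 (g12). OURS (cell res-hironaka, slot W4.2); NOT statements of H. Hironaka's
manuscript [Hironaka2017] nor of [CossartJannsenSaito2020] / [Kollar2007]; AI-typed, weaker than expert review. Helper VOCABULARY
`--supports stmt-ResolutionOfSingularities-19249 --as helper` (counted 0): definitions + proved bookkeeping lemmas; NO row is claimed.
Additive over res-L1-type-o1's boundary STATE layer `…Corridor3SigmaBoundaryDefs` (p523041: `Sigma.Boundary W := List W.IdealSheafData`,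
`MarkedStageE`); nothing landed is touched.

## Why (RULINGS v3.14-11c (CT), «σ-DESIGN CONSTRAINT INTRINSIC MENU»)

Scheme-side, player A of the σ-design may only name INTRINSIC centres at the marked point `x` of a stage `W` with boundary `E`: the point;
the irreducible components through `x` of `X(ν) = Scheme.hsStratum W N ν`; and, for every sub-family `K` of the boundary members through `x`,
the components through `x` of the E-stratum `X(ν) ∩ ⋂_{I ∈ K} V(I)` (faces using FREE coordinates are not nameable). At a FULL CORNER (`x` on
`≥ 3` members) every legal face is intrinsic (cell (E4-corner)); off full corners the menu is the honest restriction (cell (E4-partial), r-52).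

## Contents (namespace `…Theorems.SigmaMaxModificationsCorridor3.Sigma`)

* §1 `membersThrough E x` (the boundary members whose support contains `x`, in boundary order), `boundaryStratum N ν K`
  (`X(ν) ∩ ⋂_{I ∈ K} V(I)`), `IntrinsicMenuAt E N ν x : Set (Set W)` and its `Closeds`-valued reading `IntrinsicMenuClosedsAt`; every
  menu member contains `x`, lies in `X(ν)` (for `x ∈ X(ν)`, `X(ν)` closed) and is closed; **the menu is FINITE** on a noetherian stage
  (`intrinsicMenuAt_finite`: finitely many sub-families × `componentsIn.finite`).
* (sibling `…Corridor3SigmaMenuPlus.lean`: `IntrinsicMenuPlusAt` — the WIDER menu of RULINGS (CT)'s gloss, also cut by sub-families of the stratum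
  components through `x` («their intersections»); the planner picks which name ω_ρ reads.)
* §2 CENTRES FROM THE MENU: `menuCentre Z := Scheme.IdealSheafData.vanishingIdeal Z` (reduced structure), `IsMenuCentreAt E N ν x C`
  («`C` is the reduced structure on a menu member AND `C.subscheme` is regular» — regularity is a HYPOTHESIS, tri-1 V8-d, never automatic),
  and **«a regular menu member is `ν`-PERMISSIBLE»** BY NAME from the tree's
  `isPermissible_of_isRegular_subscheme_of_support_subset_hsStratum_of_isExcellent` (040's centre package uses the same lemma):
  `isPermissible_menuCentre`, `IsMenuCentreAt.isPermissible`, plus the admissibility-clause package `IsMenuCentreAt.admissibleClause`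
  (permissible ∧ support ⊆ `X(ν)` ∧ support non-empty) — the shape of clause (a) of `IsAdmissibleStrategyOnE`.
* §3 `IsFullCorner E x : Prop := 3 ≤ (membersThrough E x).length` (threefold frame), `fullCornerLocus E N ν`, the honest finiteness binder
  `Boundary.TripleMeetsFinite E` («any three members with distinct INDICES meet in a finite set» — SNC-type properness is NOT in the type
  of `Boundary`, so it is a named hypothesis) and `fullCornerLocus_finite` under it.
-/

noncomputable section

set_option linter.dupNamespace false

open CategoryTheory AlgebraicGeometry TopologicalSpace
open Summit.ResolutionOfSingularities.ResolutionOfSingularities.Theorems.CampaignW42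
open Literature.AlgebraicGeometry.Resolution Literature.RingTheory.HilbertSamuel
open Summit.ResolutionOfSingularities.ResolutionOfSingularities.Theorems.SigmaMaxModificationsCorridor3.Helpers
  (isPermissible_of_isRegular_subscheme_of_support_subset_hsStratum_of_isExcellent)

namespace Summit.ResolutionOfSingularities.ResolutionOfSingularities.Theorems.SigmaMaxModificationsCorridor3.Sigma

universe u

variable {W : Scheme.{u}}

/-! ## §1. Boundary members through a point, E-strata, the intrinsic menu -/

open scoped Classical in
/-- [OURS · L1 W4.2] **THE BOUNDARY MEMBERS THROUGH `x`**: the sub-list of the boundary `E` (in boundary order) of the members `I` with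
`x ∈ V(I)` (`I.support`). The boundary INDICES `B(x)` of RULINGS (CT). NOT a statement of the manuscript. [folklore] -/
def membersThrough (E : Boundary W) (x : W) : List W.IdealSheafData :=
  E.filter fun I => x ∈ (I.support : Set W)

/-- Membership: a member through `x` is a boundary member containing `x`. [folklore] -/
theorem mem_membersThrough_iff {E : Boundary W} {x : W} {I : W.IdealSheafData} :
    I ∈ membersThrough E x ↔ I ∈ E ∧ x ∈ (I.support : Set W) := by
  classical
  simp [membersThrough, List.mem_filter]

/-- `membersThrough E x` is a sub-list of the boundary. [folklore] -/
theorem membersThrough_sublist (E : Boundary W) (x : W) : (membersThrough E x).Sublist E := by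
  classical
  exact List.filter_sublist

/-- No boundary, no members. [folklore] -/
@[simp] theorem membersThrough_nil (x : W) : membersThrough ([] : Boundary W) x = [] := by
  classical exact List.filter_nil

/-- [OURS · L1 W4.2] **THE E-STRATUM cut by the sub-family `K`**: `X(ν) ∩ ⋂_{I ∈ K} V(I)` (for `K = []` the `ν`-stratum itself).
NOT a statement of the manuscript. [folklore] -/
def boundaryStratum (W : Scheme.{u}) (N : ℕ) (ν : ℕ → ℕ) (K : List W.IdealSheafData) : Set W :=
  {y | y ∈ Scheme.hsStratum W N ν ∧ ∀ I ∈ K, y ∈ (I.support : Set W)}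

/-- The E-stratum lies in the `ν`-stratum. [folklore] -/
theorem boundaryStratum_subset_hsStratum (N : ℕ) (ν : ℕ → ℕ) (K : List W.IdealSheafData) :
    boundaryStratum W N ν K ⊆ Scheme.hsStratum W N ν := fun _ hy => hy.1

/-- The empty sub-family cuts nothing. [folklore] -/
@[simp] theorem boundaryStratum_nil (N : ℕ) (ν : ℕ → ℕ) : boundaryStratum W N ν [] = Scheme.hsStratum W N ν := by
  ext y; simp [boundaryStratum]

/-- The E-stratum is closed once the `ν`-stratum is (supports of ideal sheaves are closed). [folklore] -/
theorem isClosed_boundaryStratum {N : ℕ} {ν : ℕ → ℕ} (hY : IsClosed (Scheme.hsStratum W N ν))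
    (K : List W.IdealSheafData) : IsClosed (boundaryStratum W N ν K) := by
  have : boundaryStratum W N ν K = Scheme.hsStratum W N ν ∩ ⋂ I ∈ K, (I.support : Set W) := by
    ext y; simp [boundaryStratum, Set.mem_iInter]
  rw [this]
  exact hY.inter (isClosed_biInter fun I _ => I.support.isClosed)

/-- A point of the stratum on every member of `K` lies in the E-stratum of `K`. [folklore] -/
theorem mem_boundaryStratum_of_forall {N : ℕ} {ν : ℕ → ℕ} {K : List W.IdealSheafData} {x : W}
    (hx : x ∈ Scheme.hsStratum W N ν) (hK : ∀ I ∈ K, x ∈ (I.support : Set W)) : x ∈ boundaryStratum W N ν K :=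
  ⟨hx, hK⟩

/-- [OURS · L1 W4.2] **THE INTRINSIC MENU AT `x`** (RULINGS v3.14-11c (CS)/(CT)): the closed point `closure {x}`, together with, for
every sub-family `K` of the boundary members through `x` (`K = []` included: the components of `X(ν)` through `x`), the irreducible
components THROUGH `x` of the E-stratum `X(ν) ∩ ⋂_{I ∈ K} V(I)` (tree `componentsIn`). These are the only centres a boundary-reading
strategy may name at `x`. Typed as a set of SUBSETS of `W`; `IntrinsicMenuClosedsAt` is the `Closeds`-valued reading. NOT a statement
of the manuscript. [folklore] -/
def IntrinsicMenuAt (E : Boundary W) (N : ℕ) (ν : ℕ → ℕ) (x : W) : Set (Set W) :=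
  {closure {x}} ∪
    {Z | ∃ K ∈ (membersThrough E x).sublists, Z ∈ componentsIn (boundaryStratum W N ν K) ∧ x ∈ Z}

/-- [OURS · L1 W4.2] the intrinsic menu read in `Closeds W` (the signature of RULINGS (CS)). [folklore] -/
def IntrinsicMenuClosedsAt (E : Boundary W) (N : ℕ) (ν : ℕ → ℕ) (x : W) : Set (Closeds W) :=
  {Z | (Z : Set W) ∈ IntrinsicMenuAt E N ν x}

/-- The point is on the menu. [folklore] -/
theorem closure_singleton_mem_intrinsicMenuAt (E : Boundary W) (N : ℕ) (ν : ℕ → ℕ) (x : W) :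
    closure {x} ∈ IntrinsicMenuAt E N ν x :=
  Or.inl rfl

/-- A component through `x` of an E-stratum cut by members through `x` is on the menu. [folklore] -/
theorem mem_intrinsicMenuAt_of_mem_componentsIn {E : Boundary W} {N : ℕ} {ν : ℕ → ℕ} {x : W} {K : List W.IdealSheafData}
    (hK : K.Sublist (membersThrough E x)) {Z : Set W} (hZ : Z ∈ componentsIn (boundaryStratum W N ν K)) (hx : x ∈ Z) :
    Z ∈ IntrinsicMenuAt E N ν x :=
  Or.inr ⟨K, List.mem_sublists.mpr hK, hZ, hx⟩

/-- In particular (`K = []`): a component of `X(ν)` through `x` is on the menu. [folklore] -/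
theorem mem_intrinsicMenuAt_of_mem_componentsIn_hsStratum {E : Boundary W} {N : ℕ} {ν : ℕ → ℕ} {x : W} {Z : Set W}
    (hZ : Z ∈ componentsIn (Scheme.hsStratum W N ν)) (hx : x ∈ Z) : Z ∈ IntrinsicMenuAt E N ν x :=
  mem_intrinsicMenuAt_of_mem_componentsIn (List.nil_sublist _) (by simpa using hZ) hx

/-- Unfolding the menu. [folklore] -/
theorem mem_intrinsicMenuAt_iff {E : Boundary W} {N : ℕ} {ν : ℕ → ℕ} {x : W} {Z : Set W} :
    Z ∈ IntrinsicMenuAt E N ν x ↔ Z = closure {x} ∨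
      ∃ K, K.Sublist (membersThrough E x) ∧ Z ∈ componentsIn (boundaryStratum W N ν K) ∧ x ∈ Z := by
  simp only [IntrinsicMenuAt, Set.mem_union, Set.mem_singleton_iff, Set.mem_setOf_eq, List.mem_sublists]

/-- **Every menu member contains the point.** [folklore] -/
theorem mem_of_mem_intrinsicMenuAt {E : Boundary W} {N : ℕ} {ν : ℕ → ℕ} {x : W} {Z : Set W}
    (hZ : Z ∈ IntrinsicMenuAt E N ν x) : x ∈ Z := by
  rcases mem_intrinsicMenuAt_iff.mp hZ with rfl | ⟨_, _, _, hx⟩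
  · exact subset_closure rfl
  · exact hx

/-- **Every menu member lies in the `ν`-stratum** (for `x ∈ X(ν)` and `X(ν)` closed — the case of a `ν`-maximal stage). [folklore] -/
theorem subset_hsStratum_of_mem_intrinsicMenuAt {E : Boundary W} {N : ℕ} {ν : ℕ → ℕ} {x : W} {Z : Set W}
    (hY : IsClosed (Scheme.hsStratum W N ν)) (hx : x ∈ Scheme.hsStratum W N ν) (hZ : Z ∈ IntrinsicMenuAt E N ν x) :
    Z ⊆ Scheme.hsStratum W N ν := by
  rcases mem_intrinsicMenuAt_iff.mp hZ with rfl | ⟨K, _, hZK, _⟩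
  · exact hY.closure_subset_iff.mpr (Set.singleton_subset_iff.mpr hx)
  · exact (componentsIn.subset hZK).trans (boundaryStratum_subset_hsStratum N ν K)

/-- **Every menu member is closed** (on a stage whose `ν`-stratum is closed). [folklore] -/
theorem isClosed_of_mem_intrinsicMenuAt {E : Boundary W} {N : ℕ} {ν : ℕ → ℕ} {x : W} {Z : Set W}
    (hY : IsClosed (Scheme.hsStratum W N ν)) (hZ : Z ∈ IntrinsicMenuAt E N ν x) : IsClosed Z := by
  rcases mem_intrinsicMenuAt_iff.mp hZ with rfl | ⟨K, _, hZK, _⟩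
  · exact isClosed_closure
  · exact componentsIn.isClosed (isClosed_boundaryStratum hY K) hZK

/-- **Every menu member is irreducible.** [folklore] -/
theorem isIrreducible_of_mem_intrinsicMenuAt {E : Boundary W} {N : ℕ} {ν : ℕ → ℕ} {x : W} {Z : Set W}
    (hZ : Z ∈ IntrinsicMenuAt E N ν x) : IsIrreducible Z := by
  rcases mem_intrinsicMenuAt_iff.mp hZ with rfl | ⟨K, _, hZK, _⟩
  · exact isIrreducible_singleton.closure
  · exact componentsIn.isIrreducible hZK

/-- **THE MENU IS FINITE** on a (topologically) noetherian stage: finitely many sub-families of the members through `x`, each cutting an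
E-stratum with finitely many irreducible components (`componentsIn.finite`). [folklore] -/
theorem intrinsicMenuAt_finite [NoetherianSpace W] (E : Boundary W) (N : ℕ) (ν : ℕ → ℕ) (x : W) :
    (IntrinsicMenuAt E N ν x).Finite := by
  refine (Set.finite_singleton _).union ?_
  have hfin : (⋃ K ∈ (membersThrough E x).sublists, componentsIn (boundaryStratum W N ν K)).Finite :=
    Set.Finite.biUnion (List.finite_toSet _) fun K _ => componentsIn.finite _
  refine hfin.subset ?_
  rintro Z ⟨K, hK, hZ, -⟩
  exact Set.mem_biUnion hK hZ

/-- … hence so is its `Closeds` reading. [folklore] -/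
theorem intrinsicMenuClosedsAt_finite [NoetherianSpace W] (E : Boundary W) (N : ℕ) (ν : ℕ → ℕ) (x : W) :
    (IntrinsicMenuClosedsAt E N ν x).Finite :=
  (intrinsicMenuAt_finite E N ν x).preimage fun _ _ _ _ h => Closeds.ext h

/-! ## §2. Centres from the menu: reduced structure, regularity as a hypothesis, permissibility by name -/

/-- [OURS · L1 W4.2] **THE CENTRE ON A MENU MEMBER**: the reduced closed-subscheme structure `Scheme.IdealSheafData.vanishingIdeal Z` (as for
every centre of the cell's towers, `BlowupTower.isBlowup`). [folklore] -/
abbrev menuCentre (Z : Closeds W) : W.IdealSheafData :=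
  Scheme.IdealSheafData.vanishingIdeal Z

/-- The support of the centre on `Z` is `Z`. [folklore] -/
@[simp] theorem coe_support_menuCentre (Z : Closeds W) : ((menuCentre Z).support : Set W) = Z :=
  Scheme.IdealSheafData.coe_support_vanishingIdeal Z

/-- [OURS · L1 W4.2] **`C` IS A MENU CENTRE AT `x`**: `C` is the reduced structure on a member of the intrinsic menu at `x` AND its
subscheme is REGULAR. Regularity is part of the DATUM (a hypothesis the strategy must meet when it names `C`), never automatic
(tri-1 V8-d: E-strata of `X(ν)` need not be regular off the toric scope). This is the predicate a boundary-reading oracle builds into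
the type of its centres (RULINGS (CT), last sentence). NOT a statement of the manuscript. [folklore] -/
def IsMenuCentreAt (E : Boundary W) (N : ℕ) (ν : ℕ → ℕ) (x : W) (C : W.IdealSheafData) : Prop :=
  (∃ Z : Closeds W, (Z : Set W) ∈ IntrinsicMenuAt E N ν x ∧ C = menuCentre Z) ∧ Scheme.IsRegular C.subscheme

/-- A menu centre has its support on the menu. [folklore] -/
theorem IsMenuCentreAt.support_mem {E : Boundary W} {N : ℕ} {ν : ℕ → ℕ} {x : W} {C : W.IdealSheafData}
    (h : IsMenuCentreAt E N ν x C) : (C.support : Set W) ∈ IntrinsicMenuAt E N ν x := by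
  obtain ⟨⟨Z, hZ, rfl⟩, -⟩ := h
  simpa using hZ

/-- A menu centre passes through the marked point. [folklore] -/
theorem IsMenuCentreAt.mem_support {E : Boundary W} {N : ℕ} {ν : ℕ → ℕ} {x : W} {C : W.IdealSheafData}
    (h : IsMenuCentreAt E N ν x C) : x ∈ (C.support : Set W) :=
  mem_of_mem_intrinsicMenuAt h.support_mem

/-- A menu centre lies in the `ν`-stratum (`x ∈ X(ν)`, `X(ν)` closed). [folklore] -/
theorem IsMenuCentreAt.support_subset_hsStratum {E : Boundary W} {N : ℕ} {ν : ℕ → ℕ} {x : W} {C : W.IdealSheafData}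
    (h : IsMenuCentreAt E N ν x C) (hY : IsClosed (Scheme.hsStratum W N ν)) (hx : x ∈ Scheme.hsStratum W N ν) :
    (C.support : Set W) ⊆ Scheme.hsStratum W N ν :=
  subset_hsStratum_of_mem_intrinsicMenuAt hY hx h.support_mem

/-- **A REGULAR MENU MEMBER IS `ν`-PERMISSIBLE** (BY NAME: the tree's
`isPermissible_of_isRegular_subscheme_of_support_subset_hsStratum_of_isExcellent`, CJS Def. 3.1 (2) / Thm. 3.3 / Lemma 2.31): on a reduced
excellent stage of dimension `≤ N` with `ν ≠ Φ^{(N)}` (the regular value), the reduced structure on a menu member at a point `x ∈ X(ν)`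
(`X(ν)` closed) is permissible AS SOON AS it is regular. [cite: CossartJannsenSaito2020, Def. 3.1 (2), Thm. 3.3] -/
theorem isPermissible_menuCentre [IsLocallyNoetherian W] [IsReduced W] (hexc : Scheme.IsExcellent W) {N : ℕ}
    (hdim : topologicalKrullDim W ≤ (N : WithBot ℕ∞)) {ν : ℕ → ℕ} (hν : ν ≠ iterPSum N Phi)
    {E : Boundary W} {x : W} (hY : IsClosed (Scheme.hsStratum W N ν)) (hx : x ∈ Scheme.hsStratum W N ν)
    {Z : Closeds W} (hZ : (Z : Set W) ∈ IntrinsicMenuAt E N ν x) (hreg : Scheme.IsRegular (menuCentre Z).subscheme) :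
    IdealSheafData.IsPermissible (menuCentre Z) :=
  isPermissible_of_isRegular_subscheme_of_support_subset_hsStratum_of_isExcellent hexc hdim hν (menuCentre Z) hreg
    (by rw [coe_support_menuCentre]; exact subset_hsStratum_of_mem_intrinsicMenuAt hY hx hZ)

/-- **A menu centre is permissible** (same hypotheses; regularity is inside `IsMenuCentreAt`). [cite: CossartJannsenSaito2020, Def. 3.1 (2), Thm. 3.3] -/
theorem IsMenuCentreAt.isPermissible [IsLocallyNoetherian W] [IsReduced W] (hexc : Scheme.IsExcellent W) {N : ℕ}
    (hdim : topologicalKrullDim W ≤ (N : WithBot ℕ∞)) {ν : ℕ → ℕ} (hν : ν ≠ iterPSum N Phi)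
    {E : Boundary W} {x : W} (hY : IsClosed (Scheme.hsStratum W N ν)) (hx : x ∈ Scheme.hsStratum W N ν)
    {C : W.IdealSheafData} (h : IsMenuCentreAt E N ν x C) : IdealSheafData.IsPermissible C := by
  obtain ⟨⟨Z, hZ, rfl⟩, hreg⟩ := h
  exact isPermissible_menuCentre hexc hdim hν hY hx hZ hreg

/-- **THE ADMISSIBILITY CLAUSE for a menu centre** — the shape of clause (a) of `IsAdmissibleStrategyOnE` for a step whose centre is a
menu centre at the marked point: permissible, inside the `ν`-stratum, and non-empty (it contains `x`). [cite: CossartJannsenSaito2020, Def. 3.1, Rem. 6.29 (1)] -/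
theorem IsMenuCentreAt.admissibleClause [IsLocallyNoetherian W] [IsReduced W] (hexc : Scheme.IsExcellent W) {N : ℕ}
    (hdim : topologicalKrullDim W ≤ (N : WithBot ℕ∞)) {ν : ℕ → ℕ} (hν : ν ≠ iterPSum N Phi)
    {E : Boundary W} {x : W} (hY : IsClosed (Scheme.hsStratum W N ν)) (hx : x ∈ Scheme.hsStratum W N ν)
    {C : W.IdealSheafData} (h : IsMenuCentreAt E N ν x C) :
    IdealSheafData.IsPermissible C ∧ (C.support : Set W) ⊆ Scheme.hsStratum W N ν ∧
      ((Scheme.hsStratum W N ν).Nonempty → (C.support : Set W).Nonempty) :=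
  ⟨h.isPermissible hexc hdim hν hY hx, h.support_subset_hsStratum hY hx, fun _ => ⟨x, h.mem_support⟩⟩

/-- The point centre is a menu centre whenever it is regular as a reduced subscheme (a closed point with its reduced structure is
the spectrum of its residue field — regularity is still recorded as the hypothesis it is in the type). [folklore] -/
theorem isMenuCentreAt_point {E : Boundary W} {N : ℕ} {ν : ℕ → ℕ} {x : W}
    (hreg : Scheme.IsRegular (menuCentre ⟨closure {x}, isClosed_closure⟩ : W.IdealSheafData).subscheme) :
    IsMenuCentreAt E N ν x (menuCentre ⟨closure {x}, isClosed_closure⟩) :=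
  ⟨⟨⟨closure {x}, isClosed_closure⟩, closure_singleton_mem_intrinsicMenuAt E N ν x, rfl⟩, hreg⟩

/-! ## §3. Full corners and the full-corner locus -/

/-- [OURS · L1 W4.2] **`x` IS A FULL CORNER of the boundary** (threefold frame): at least three boundary members pass through `x` — the whole
regular frame at `x` is boundary, every legal face of the polyhedra game is intrinsic (cell (E4-corner) of RULINGS (CT)). NOT a statement of
the manuscript. [folklore] -/
def IsFullCorner (E : Boundary W) (x : W) : Prop :=
  3 ≤ (membersThrough E x).length

/-- [OURS · L1 W4.2] **THE FULL-CORNER LOCUS** of the `ν`-stratum. [folklore] -/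
def fullCornerLocus (E : Boundary W) (N : ℕ) (ν : ℕ → ℕ) : Set W :=
  {x | x ∈ Scheme.hsStratum W N ν ∧ IsFullCorner E x}

/-- The full-corner locus lies in the stratum. [folklore] -/
theorem fullCornerLocus_subset_hsStratum (E : Boundary W) (N : ℕ) (ν : ℕ → ℕ) :
    fullCornerLocus E N ν ⊆ Scheme.hsStratum W N ν := fun _ hx => hx.1

/-- No boundary, no full corner (every maximal ORIGIN starts with `E₀ = []`: RULINGS (CT), «B = ∅ starts»). [folklore] -/
@[simp] theorem not_isFullCorner_nil (x : W) : ¬ IsFullCorner ([] : Boundary W) x := by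
  simp [IsFullCorner]

/-- … so the initial full-corner locus is empty. [folklore] -/
@[simp] theorem fullCornerLocus_nil (N : ℕ) (ν : ℕ → ℕ) : fullCornerLocus ([] : Boundary W) N ν = ∅ := by
  ext x; simp [fullCornerLocus]

/-- [OURS · L1 W4.2] **HONEST FINITENESS BINDER**: any three boundary members with pairwise distinct INDICES meet in a finite set. SNC-type
properness is not part of the type `Boundary W = List W.IdealSheafData` (o1's §1), so this is the named hypothesis under which the
full-corner locus is finite; it holds for the boundary a run creates on a noetherian threefold when the members are the distinct exceptional
divisors in general position, and FAILS for a list with a repeated positive-dimensional member. NOT a statement of the manuscript. [folklore] -/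
def Boundary.TripleMeetsFinite (E : Boundary W) : Prop :=
  ∀ i j k : Fin E.length, i < j → j < k →
    ((E.get i).support ∩ (E.get j).support ∩ (E.get k).support : Set W).Finite

/-- A full corner lies on three boundary members with increasing indices. [folklore] -/
theorem IsFullCorner.exists_indices {E : Boundary W} {x : W} (h : IsFullCorner E x) :
    ∃ i j k : Fin E.length, i < j ∧ j < k ∧ x ∈ ((E.get i).support : Set W) ∧ x ∈ ((E.get j).support : Set W) ∧
      x ∈ ((E.get k).support : Set W) := by
  classical
  obtain ⟨f, hf⟩ := List.sublist_iff_exists_fin_orderEmbedding_get_eq.mp (membersThrough_sublist E x)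
  have hlen : 3 ≤ (membersThrough E x).length := h
  have hmem : ∀ a : Fin (membersThrough E x).length, x ∈ ((E.get (f a)).support : Set W) := fun a => by
    rw [← hf a]
    exact (mem_membersThrough_iff.mp (List.get_mem _ a)).2
  refine ⟨f ⟨0, by omega⟩, f ⟨1, by omega⟩, f ⟨2, by omega⟩, ?_, ?_, hmem _, hmem _, hmem _⟩
  · exact f.lt_iff_lt.mpr (by simp [Fin.lt_def])
  · exact f.lt_iff_lt.mpr (by simp [Fin.lt_def])

/-- **THE FULL-CORNER LOCUS IS FINITE** under the triple-intersection binder: it lies in the (finite) union over index triples of the triple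
intersections. [folklore] -/
theorem fullCornerLocus_finite {E : Boundary W} (hE : E.TripleMeetsFinite) (N : ℕ) (ν : ℕ → ℕ) :
    (fullCornerLocus E N ν).Finite := by
  have hfin : (⋃ t : Fin E.length × Fin E.length × Fin E.length,
      {y : W | t.1 < t.2.1 ∧ t.2.1 < t.2.2 ∧ y ∈ ((E.get t.1).support ∩ (E.get t.2.1).support ∩ (E.get t.2.2).support : Set W)}).Finite := by
    refine Set.finite_iUnion fun t => ?_
    by_cases ht : t.1 < t.2.1 ∧ t.2.1 < t.2.2
    · exact (hE t.1 t.2.1 t.2.2 ht.1 ht.2).subset fun y hy => hy.2.2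
    · exact (Set.finite_empty).subset fun y hy => ht ⟨hy.1, hy.2.1⟩
  refine hfin.subset ?_
  rintro y ⟨-, hy⟩
  obtain ⟨i, j, k, hij, hjk, hi, hj, hk⟩ := hy.exists_indices
  exact Set.mem_iUnion.mpr ⟨(i, j, k), hij, hjk, ⟨hi, hj⟩, hk⟩

end Summit.ResolutionOfSingularities.ResolutionOfSingularities.Theorems.SigmaMaxModificationsCorridor3.Sigma

end
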